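import Literature.Probability.RandomPlanarGeometry.LoewnerBoundaryExtension
import Literature.Probability.RandomPlanarGeometry.CaratheodoryExtension
import Literature.Analysis.Complex.UpperHalfPlaneSegmentUniqueness
import Literature.Topology.PlaneTopology.JordanCurveProofs
import HarnessLib

/-!
# The tip of a Loewner chain at a first-visit time has a unique real preimage

Trunk T-STOCH, deterministic Loewner theory. Let the chordal Loewner chain of the continuous
driving function `W` be generated by the curve `γ`, and let `f̄ₜ = extendFrom ℍₒ fₜ`
(`Loewner.bdryInv`, the continuous extension of `fₜ = gₜ⁻¹` to the closed half-plane, Lawler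
(2005), Prop. 4.31 / Rem. 4.32). We prove
(`Loewner.IsGeneratedByCurve.eq_driving_of_extendFrom_loewnerInv_eq`): if `t` is a
**first-visit time**, `γ t ∉ γ [0, t)`, then the only real `x` with `f̄ₜ x = γ t` is `x = W t`.
In the language of prime ends (Pommerenke (1992), §2.4): the tip `γ(t)` of a chain generated by
a curve, at a time at which it has not been visited before, is the principal point of exactly
ONE prime end of `Hₜ = ℍₒ ∖ Kₜ`, namely the one at `W(t)` (the tree's
`IsGeneratedByCurve.eq_driving_of_bdryInv_eq` is the case of a simple curve).

**Proof.** Suppose `f̄ₜ a = f̄ₜ b = z := γ t` with `a < b` (`t > 0`; `f̄₀ = id`). The image under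
`f̄ₜ` of the semicircle in `ℍ̄ₒ` on `[a, b]` is a Jordan curve `J ⊆ Hₜ ∪ {z}` (`fₜ` is injective
and `z ∉ Hₜ`). By the Jordan curve theorem (`PlaneTopology.JordanCurveTheorem_holds`)
`ℂ ∖ J = A ⊔ B` with `∂A = ∂B = J`; the images of the inside `S₁` and of the outside `S₂` of the
semicircle in `ℍₒ` are connected, miss `J`, and lie in different components (a point of
`J ∩ Hₜ` is a frontier point of both, and nearby points of `Hₜ ∖ J` come from `S₁ ∪ S₂`), say
`fₜ S₁ ⊆ A`, `fₜ S₂ ⊆ B`. Boundary values of `fₜ` on `(a, b)` are limits from `S₁`, so lie in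
`Ā ∩ ∂Hₜ ⊆ A ∪ {z}`; beyond `b` they lie in `B ∪ {z}`. They are not constantly `z` on an
interval (Schwarz reflection and the identity theorem,
`Literature.Analysis.Complex.eq_zero_of_eqOn_real_segment`), giving boundary points
`p ∈ A ∩ ∂Hₜ`, `p' ∈ B ∩ ∂Hₜ` off `z`. But `∂Hₜ ⊆ γ[0, t] ∪ ℝ` and `t` is a first-visit time,
so `∂Hₜ ∖ {z} ⊆ M := ({im ≤ 0} ∖ {z}) ∪ γ [0, t)`, a connected set (the pieces meet at
`γ 0 = W 0 ≠ z`) missing `J ⊆ (ℍₒ ∖ γ[0, t]) ∪ {z}`: `p, p'` lie in one component, absurd.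

## References

* G. F. Lawler, *Conformally Invariant Processes in the Plane*, AMS (2005), §4.1, §4.4
  (Prop. 4.31, Rem. 4.32).
* Ch. Pommerenke, *Boundary Behaviour of Conformal Maps*, Springer (1992), §2.4 (prime ends),
  Thm. 2.6.
-/

noncomputable section

open Set Filter Topology Metric Complex
open UpperHalfPlane (upperHalfPlaneSet isOpen_upperHalfPlaneSet)
open scoped NNReal

namespace Literature.Probability.RandomPlanarGeometry

namespace Loewner

/-! ### Semicircles in the upper half-plane -/

section Semicircle

/-- The imaginary part along a circle with real centre. [folklore] -/
theorem circleMap_ofReal_im (c ρ θ : ℝ) : (circleMap (c : ℂ) ρ θ).im = ρ * Real.sin θ := by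
  simp only [circleMap, Complex.add_im, Complex.ofReal_im, Complex.im_ofReal_mul,
    Complex.exp_ofReal_mul_I_im, zero_add]

/-- A circle map is injective on the angles `[0, π]`. [folklore] -/
theorem injOn_circleMap_Icc {c : ℂ} {ρ : ℝ} (hρ : ρ ≠ 0) :
    InjOn (circleMap c ρ) (Icc 0 Real.pi) := fun θ hθ θ' hθ' h ↦ eq_of_circleMap_eq hρ
  (by rw [abs_lt]; constructor <;> linarith [hθ.1, hθ.2, hθ'.1, hθ'.2, Real.pi_pos]) h

/-- Polar coordinates about a real centre: a point of the open upper half-plane is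
`c + r e^{iθ}` with `r` its distance to `c` and `θ ∈ (0, π)`. [folklore] -/
theorem exists_circleMap_eq_of_im_pos (c : ℝ) {w : ℂ} (hw : 0 < w.im) :
    ∃ θ ∈ Ioo 0 Real.pi, circleMap (c : ℂ) (dist w c) θ = w := by
  have him : (w - c).im = w.im := by simp
  refine ⟨arg (w - c), ⟨?_, ?_⟩, ?_⟩
  · refine lt_of_le_of_ne (arg_nonneg_iff.2 (by rw [him]; exact hw.le)) fun h ↦ hw.ne' ?_
    rw [← him]; exact (arg_eq_zero_iff.1 h.symm).2
  · refine lt_of_le_of_ne (arg_le_pi (w - c)) fun h ↦ hw.ne' ?_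
    rw [← him]; exact (arg_eq_pi_iff.1 h).2
  · simp only [circleMap]
    rw [Complex.dist_eq, norm_mul_exp_arg_mul_I, add_sub_cancel]

/-- The part of the open upper half-plane outside a closed disc with real centre is connected
(polar coordinates). [folklore] -/
theorem isPreconnected_upperHalfPlaneSet_inter_compl_closedBall (c : ℝ) {ρ : ℝ} (hρ : 0 < ρ) :
    IsPreconnected (upperHalfPlaneSet ∩ (closedBall (c : ℂ) ρ)ᶜ) := by
  have heq : (fun q : ℝ × ℝ ↦ circleMap (c : ℂ) q.1 q.2) '' Ioi ρ ×ˢ Ioo 0 Real.pi =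
      upperHalfPlaneSet ∩ (closedBall (c : ℂ) ρ)ᶜ := by
    ext w
    constructor
    · rintro ⟨⟨r, θ⟩, ⟨hr, hθ⟩, rfl⟩
      have hr0 : 0 < r := hρ.trans hr
      refine ⟨show 0 < (circleMap (c : ℂ) r θ).im from ?_, ?_⟩
      · rw [circleMap_ofReal_im]; exact mul_pos hr0 (Real.sin_pos_of_pos_of_lt_pi hθ.1 hθ.2)
      · rw [mem_compl_iff, mem_closedBall, not_le, mem_sphere.1 (circleMap_mem_sphere _ hr0.le θ)]
        exact hr
    · rintro ⟨hw, hwc⟩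
      rw [mem_compl_iff, mem_closedBall, not_le] at hwc
      obtain ⟨θ, hθ, hθw⟩ := exists_circleMap_eq_of_im_pos c hw
      exact ⟨(dist w c, θ), ⟨hwc, hθ⟩, hθw⟩
  rw [← heq]
  refine (isPreconnected_Ioi.prod isPreconnected_Ioo).image _ (Continuous.continuousOn ?_)
  simp only [circleMap]; fun_prop

end Semicircle

/-! ### The tip at a first-visit time -/

section Tip

variable {W : ℝ≥0 → ℝ} {γ : ℝ≥0 → ℂ}

/-- `f̄₀ = id` on the real line (`f₀ = id` on `ℍₒ`, `loewnerInv_zero_apply`). [folklore] -/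
theorem IsGeneratedByCurve.bdryInv_zero_ofReal (hγ : IsGeneratedByCurve W γ) (hW : Continuous W)
    (x : ℝ) : bdryInv W 0 x = x := by
  haveI := neBot_nhdsWithin_ofReal x
  refine tendsto_nhds_unique (hγ.tendsto_bdryInv hW 0 (by simp)) ?_
  refine (tendsto_nhdsWithin_of_tendsto_nhds tendsto_id).congr' ?_
  filter_upwards [self_mem_nhdsWithin] with w hw
  exact (loewnerInv_zero_apply hW hw).symm

/-- **Boundary values of `fₜ` are not locally constant**: `f̄ₜ` is not constant on any real
interval (Schwarz reflection and the identity theorem would make `fₜ` constant on `ℍₒ`, but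
`fₜ (ℍₒ) = Hₜ` misses `∂Hₜ ∋ f̄ₜ a'`). [folklore] -/
theorem IsGeneratedByCurve.exists_bdryInv_ne (hγ : IsGeneratedByCurve W γ) (hW : Continuous W)
    (t : ℝ≥0) {a' b' : ℝ} (hab : a' < b') (q : ℂ) (hq : q ∉ domain W t) :
    ∃ x ∈ Ioo a' b', bdryInv W t x ≠ q := by
  by_contra hcon
  push Not at hcon
  have hd : DifferentiableOn ℂ (fun w ↦ bdryInv W t w - q) {w : ℂ | 0 < w.im} :=
    ((differentiableOn_invFunOn_map hW t).congr fun w hw ↦ bdryInv_eq_of_mem hW t hw).sub_const q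
  have hc : ∀ x : ℝ, x ∈ Ioo a' b' → ContinuousWithinAt (fun w ↦ bdryInv W t w - q)
      {w : ℂ | 0 ≤ w.im} x :=
    fun x _ ↦ (hγ.continuousOn_bdryInv hW t x (by simp)).sub continuousWithinAt_const
  have h := Literature.Analysis.Complex.eq_zero_of_eqOn_real_segment hab hd hc
    (fun x hx ↦ by simp [hcon x hx]) (z := I) (by simp)
  rw [sub_eq_zero] at h
  exact hq (h ▸ bdryInv_mem_domain hW t (show (0 : ℝ) < I.im by simp))

/-- **No two real points over a first-visit tip.** For `t > 0` with `γ t ∉ γ [0, t)`, there are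
no real `a < b` with `f̄ₜ a = f̄ₜ b = γ t` (the Jordan-curve argument of the module docstring).
[cite: PommerenkeBBCM1992, §2.4 (prime ends)] -/
theorem IsGeneratedByCurve.false_of_bdryInv_eq_of_lt (hγ : IsGeneratedByCurve W γ)
    (hW : Continuous W) {t : ℝ≥0} (ht0 : 0 < t) (ht : γ t ∉ γ '' Iio t) {a b : ℝ} (hab : a < b)
    (ha : bdryInv W t a = γ t) (hb : bdryInv W t b = γ t) : False := by
  -- the players
  set F : ℂ → ℂ := bdryInv W t with hFdef
  set G : Set ℂ := domain W t with hGdef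
  set z : ℂ := γ t with hzdef
  have hGo : IsOpen G := isOpen_domain hW t
  have hGH : G ⊆ upperHalfPlaneSet := domain_subset W t
  have hGγ : ∀ q ∈ G, q ∉ γ '' Icc 0 t := fun q hq h ↦ (hγ.domain_subset_diff t hq).2 h
  have hzγ : z ∈ γ '' Icc 0 t := ⟨t, ⟨zero_le, le_rfl⟩, rfl⟩
  have hzG : z ∉ G := fun h ↦ hGγ z h hzγ
  have hzim : 0 ≤ z.im := hγ.im_nonneg t
  have hFeq : ∀ w ∈ upperHalfPlaneSet, F w = loewnerInv W t w := fun w hw ↦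
    bdryInv_eq_of_mem hW t hw
  have hFG : ∀ w ∈ upperHalfPlaneSet, F w ∈ G := fun w hw ↦ bdryInv_mem_domain hW t hw
  have hFinj : InjOn F upperHalfPlaneSet := by
    intro w hw w' hw' h
    rw [hFeq w hw, hFeq w' hw'] at h
    exact (bijOn_invFunOn_map hW t).injOn hw hw' h
  have hFsurj : ∀ q ∈ G, ∃ w ∈ upperHalfPlaneSet, F w = q := by
    intro q hq
    obtain ⟨w, hw, rfl⟩ := (bijOn_invFunOn_map hW t).surjOn hq
    exact ⟨w, hw, hFeq w hw⟩
  have hFcont : ContinuousOn F {w : ℂ | 0 ≤ w.im} := hγ.continuousOn_bdryInv hW t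
  have hFlim : ∀ x : ℝ, Tendsto (loewnerInv W t) (𝓝[upperHalfPlaneSet] (x : ℂ)) (𝓝 (F x)) :=
    fun x ↦ hγ.tendsto_bdryInv hW t (by simp)
  have hFfr : ∀ x : ℝ, F x ∈ frontier G := fun x ↦ hγ.bdryInv_ofReal_mem_frontier hW t x
  have hfrG : frontier G ⊆ γ '' Icc 0 t ∪ {w : ℂ | w.im = 0} := hγ.frontier_domain_subset hW t
  have hfrG' : ∀ q ∈ frontier G, q ∉ G := fun q hq h ↦ by
    rw [frontier, hGo.interior_eq] at hq; exact hq.2 h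
  -- the semicircle `P` on `[a, b]`
  set c : ℝ := (a + b) / 2 with hc
  set ρ : ℝ := (b - a) / 2 with hρ
  have hρ0 : 0 < ρ := by rw [hρ]; linarith
  have hca : (c : ℂ) - ρ = a := by rw [← Complex.ofReal_sub, hc, hρ]; push_cast; ring
  have hcb : (c : ℂ) + ρ = b := by rw [← Complex.ofReal_add, hc, hρ]; push_cast; ring
  set P : ℝ → ℂ := fun s ↦ circleMap (c : ℂ) ρ (Real.pi * (1 - s)) with hP
  have hP0 : P 0 = a := by
    simp only [hP, sub_zero, mul_one, circleMap, Complex.exp_pi_mul_I]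
    rw [← hca]; ring
  have hP1 : P 1 = b := by
    simp only [hP, sub_self, mul_zero, circleMap, ofReal_zero, zero_mul, Complex.exp_zero, mul_one]
    exact hcb
  have hθIoo : ∀ s ∈ Ioo (0 : ℝ) 1, Real.pi * (1 - s) ∈ Ioo 0 Real.pi := fun s hs ↦
    ⟨by nlinarith [hs.2, Real.pi_pos], by nlinarith [hs.1, Real.pi_pos]⟩
  have hθIcc : ∀ s ∈ Icc (0 : ℝ) 1, Real.pi * (1 - s) ∈ Icc 0 Real.pi := fun s hs ↦
    ⟨by nlinarith [hs.2, Real.pi_pos], by nlinarith [hs.1, Real.pi_pos]⟩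
  have hPim : ∀ s ∈ Ioo (0 : ℝ) 1, 0 < (P s).im := fun s hs ↦ by
    simp only [hP, circleMap_ofReal_im]
    exact mul_pos hρ0 (Real.sin_pos_of_pos_of_lt_pi (hθIoo s hs).1 (hθIoo s hs).2)
  have hPim' : ∀ s ∈ Icc (0 : ℝ) 1, 0 ≤ (P s).im := fun s hs ↦ by
    simp only [hP, circleMap_ofReal_im]
    exact mul_nonneg hρ0.le (Real.sin_nonneg_of_nonneg_of_le_pi (hθIcc s hs).1 (hθIcc s hs).2)
  have hPdist : ∀ s, dist (P s) c = ρ := fun s ↦ mem_sphere.1 (circleMap_mem_sphere _ hρ0.le _)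
  have hPinj : InjOn P (Icc 0 1) := by
    intro s hs s' hs' h
    have := injOn_circleMap_Icc hρ0.ne' (hθIcc s hs) (hθIcc s' hs') h
    nlinarith [Real.pi_pos]
  have hPcov : ∀ w : ℂ, 0 < w.im → dist w c = ρ → ∃ s ∈ Ioo (0 : ℝ) 1, P s = w := by
    intro w hw hwc
    obtain ⟨θ, hθ, hθw⟩ := exists_circleMap_eq_of_im_pos c hw
    have hθ' : Real.pi * (1 - (1 - θ / Real.pi)) = θ := by field_simp; ring
    refine ⟨1 - θ / Real.pi, ⟨by rw [sub_pos, div_lt_one Real.pi_pos]; exact hθ.2,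
      by linarith [div_pos hθ.1 Real.pi_pos]⟩, ?_⟩
    show circleMap (c : ℂ) ρ (Real.pi * (1 - (1 - θ / Real.pi))) = w
    rw [hθ', ← hθw, hwc]
  -- the loop `p = F ∘ P` and the Jordan curve `J`
  set p : ℝ → ℂ := fun s ↦ F (P s) with hp
  have hPc : Continuous P := by simp only [hP, circleMap]; fun_prop
  have hpc : ContinuousOn p (Icc 0 1) := hFcont.comp hPc.continuousOn fun s hs ↦ hPim' s hs
  have hp0 : p 0 = z := by simp only [hp, hP0]; exact ha
  have hp1 : p 1 = z := by simp only [hp, hP1]; exact hb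
  have hpG : ∀ s ∈ Ioo (0 : ℝ) 1, p s ∈ G := fun s hs ↦ hFG _ (hPim s hs)
  have hpinj : InjOn p (Ico 0 1) := by
    intro s hs s' hs' h
    rcases hs.1.eq_or_lt with h0 | h0 <;> rcases hs'.1.eq_or_lt with h0' | h0'
    · rw [← h0, ← h0']
    · exact absurd (hpG s' ⟨h0', hs'.2⟩) (by rw [← h, ← h0, hp0]; exact hzG)
    · exact absurd (hpG s ⟨h0, hs.2⟩) (by rw [h, ← h0', hp0]; exact hzG)
    · exact hPinj ⟨hs.1, hs.2.le⟩ ⟨hs'.1, hs'.2.le⟩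
        (hFinj (hPim s ⟨h0, hs.2⟩) (hPim s' ⟨h0', hs'.2⟩) h)
  obtain ⟨Λ, hΛc, hΛp, hΛi, hΛr⟩ := exists_periodic_of_closed_arc hpc hpinj (hp0.trans hp1.symm)
  obtain ⟨U, V, hUo, hVo, -, -, hUV, hUVJ, hfU, hfV, -, -⟩ :=
    Literature.Topology.PlaneTopology.JordanCurveTheorem_holds.of_periodic hΛc hΛp hΛi
  rw [hΛr] at hUVJ hfU hfV
  set J : Set ℂ := p '' Icc 0 1 with hJ
  have hJcases : ∀ q ∈ J, q = z ∨ ∃ s ∈ Ioo (0 : ℝ) 1, p s = q := by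
    rintro q ⟨s, hs, rfl⟩
    rcases hs.1.eq_or_lt with h0 | h0
    · exact Or.inl (by rw [← h0, hp0])
    rcases hs.2.eq_or_lt with h1 | h1
    · exact Or.inl (by rw [h1, hp1])
    · exact Or.inr ⟨s, ⟨h0, h1⟩, rfl⟩
  have hJsub : ∀ q ∈ J, q ∈ G ∨ q = z := fun q hq ↦
    (hJcases q hq).elim Or.inr fun ⟨s, hs, hsq⟩ ↦ Or.inl (hsq ▸ hpG s hs)
  -- the inside `S₁` and the outside `S₂` of the semicircle
  set S₁ : Set ℂ := upperHalfPlaneSet ∩ ball (c : ℂ) ρ with hS₁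
  set S₂ : Set ℂ := upperHalfPlaneSet ∩ (closedBall (c : ℂ) ρ)ᶜ with hS₂
  have hS₁c : IsPreconnected (F '' S₁) :=
    (((convex_halfSpace_im_gt 0).inter (convex_ball _ _)).isPreconnected).image _
      (hFcont.mono fun w hw ↦ le_of_lt (show 0 < w.im from hw.1))
  have hS₂c : IsPreconnected (F '' S₂) :=
    (isPreconnected_upperHalfPlaneSet_inter_compl_closedBall c hρ0).image _
      (hFcont.mono fun w hw ↦ le_of_lt (show 0 < w.im from hw.1))
  have hcover : ∀ w ∈ upperHalfPlaneSet, w ∈ S₁ ∨ w ∈ S₂ ∨ ∃ s ∈ Ioo (0 : ℝ) 1, P s = w := by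
    intro w hw
    rcases lt_trichotomy (dist w c) ρ with h | h | h
    · exact Or.inl ⟨hw, mem_ball.2 h⟩
    · exact Or.inr (Or.inr (hPcov w hw h))
    · exact Or.inr (Or.inl ⟨hw, fun h' ↦ absurd (mem_closedBall.1 h') (not_le.2 h)⟩)
  have hSJ : ∀ w ∈ upperHalfPlaneSet, dist w c ≠ ρ → F w ∉ J := by
    intro w hw hwc hwJ
    rcases hJcases _ hwJ with h | ⟨s, hs, hsw⟩
    · exact hzG (h ▸ hFG w hw)
    · have := hFinj (hPim s hs) hw hsw
      exact hwc (this ▸ hPdist s)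
  have hS₁J : F '' S₁ ⊆ U ∪ V := by
    rw [hUVJ]; rintro _ ⟨w, hw, rfl⟩; exact hSJ w hw.1 (mem_ball.1 hw.2).ne
  have hS₂J : F '' S₂ ⊆ U ∪ V := by
    rw [hUVJ]; rintro _ ⟨w, hw, rfl⟩; exact hSJ w hw.1 fun h ↦ hw.2 (mem_closedBall.2 h.le)
  -- boundary values are limits from `S₁` on `(a, b)` and from `S₂` beyond `b`
  have hbv₁ : ∀ x ∈ Ioo a b, F x ∈ closure (F '' S₁) := by
    intro x hx
    haveI := neBot_nhdsWithin_ofReal x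
    have hxc : |x - c| < ρ := by rw [hc, hρ, abs_lt]; constructor <;> linarith [hx.1, hx.2]
    refine mem_closure_of_tendsto (hFlim x) ?_
    have hball : ball (x : ℂ) (ρ - |x - c|) ∈ 𝓝 (x : ℂ) := ball_mem_nhds _ (by linarith)
    filter_upwards [inter_mem_nhdsWithin upperHalfPlaneSet hball] with w hw
    refine ⟨w, ⟨hw.1, ?_⟩, hFeq w hw.1⟩
    rw [mem_ball]
    have h1 : dist (x : ℂ) c = |x - c| := by
      rw [Complex.dist_eq, ← Complex.ofReal_sub, Complex.norm_real, Real.norm_eq_abs]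
    calc dist w c ≤ dist w x + dist (x : ℂ) c := dist_triangle _ _ _
      _ < (ρ - |x - c|) + |x - c| := add_lt_add_of_lt_of_le (mem_ball.1 hw.2) h1.le
      _ = ρ := by ring
  have hbv₂ : ∀ x : ℝ, b < x → F x ∈ closure (F '' S₂) := by
    intro x hx
    haveI := neBot_nhdsWithin_ofReal x
    refine mem_closure_of_tendsto (hFlim x) ?_
    have hball : ball (x : ℂ) (x - b) ∈ 𝓝 (x : ℂ) := ball_mem_nhds _ (by linarith)
    filter_upwards [inter_mem_nhdsWithin upperHalfPlaneSet hball] with w hw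
    refine ⟨w, ⟨hw.1, fun hwc ↦ ?_⟩, hFeq w hw.1⟩
    have h1 : |(w - x).re| < x - b :=
      (abs_re_le_norm _).trans_lt (by rw [← Complex.dist_eq]; exact mem_ball.1 hw.2)
    have h2 : |(w - c).re| ≤ ρ :=
      (abs_re_le_norm _).trans (by rw [← Complex.dist_eq]; exact mem_closedBall.1 hwc)
    rw [Complex.sub_re, Complex.ofReal_re] at h1 h2
    rw [abs_lt] at h1; rw [abs_le, hc, hρ] at h2
    linarith [h1.1, h2.2]
  -- the connected set `M ⊇ ∂Hₜ ∖ {z}` off `J`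
  set M : Set ℂ := ({w : ℂ | w.im ≤ 0} \ {z}) ∪ γ '' Iio t with hM
  have hγ0z : γ 0 ≠ z := fun h ↦ ht ⟨0, ht0, h⟩
  have hMc : IsPreconnected M := by
    have h1 : IsPreconnected ({w : ℂ | w.im ≤ 0} \ {z}) := by
      refine (convex_halfSpace_im_lt (0 : ℝ)).isPreconnected.subset_closure
        (fun w hw ↦ ⟨show w.im ≤ 0 from le_of_lt hw, fun h ↦ ?_⟩) ?_
      · rw [mem_singleton_iff] at h; rw [h] at hw; exact (not_lt.2 hzim) hw
      · rw [closure_setOf_im_lt]; exact fun w hw ↦ hw.1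
    have h2 : IsPreconnected (γ '' Iio t) := isPreconnected_Iio.image _ hγ.continuous.continuousOn
    refine h1.union (γ 0) ⟨?_, fun h ↦ hγ0z (mem_singleton_iff.1 h)⟩ ⟨0, ht0, rfl⟩ h2
    show (γ 0).im ≤ 0
    rw [hγ.apply_zero, Complex.ofReal_im]
  have hMJ : M ⊆ U ∪ V := by
    rw [hUVJ]
    rintro q (hq | ⟨s, hs, rfl⟩) hqJ <;> rcases hJsub _ hqJ with h | h
    · exact absurd (show 0 < q.im from hGH h) (not_lt.2 hq.1)
    · exact hq.2 h
    · exact hGγ _ h ⟨s, ⟨zero_le, le_of_lt hs⟩, rfl⟩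
    · exact ht ⟨s, hs, h⟩
  have hfrM : ∀ q ∈ frontier G, q ≠ z → q ∈ M := fun q hq hqz ↦ by
    rcases hfrG hq with ⟨s, hs, rfl⟩ | h
    · exact Or.inr ⟨s, hs.2.lt_of_ne fun h ↦ hqz (by rw [h]), rfl⟩
    · exact Or.inl ⟨le_of_eq h, hqz⟩
  -- the core: `F '' S₁ ⊆ A` for a complementary component `A` of `J` is absurd
  have key : ∀ A B : Set ℂ, IsOpen A → IsOpen B → Disjoint A B → A ∪ B = Jᶜ →
      frontier A = J → frontier B = J → F '' S₁ ⊆ A → False := by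
    intro A B hAo hBo hAB hABJ hfrA hfrB h₁
    have hAB' : U ∪ V = A ∪ B := hUVJ.trans hABJ.symm
    -- `F '' S₂ ⊆ B` (frontier argument at `p (1/2) ∈ J ∩ G`)
    have h₂ : F '' S₂ ⊆ B := by
      rcases hS₂c.subset_or_subset hAo hBo hAB (hAB' ▸ hS₂J) with h | h
      · exfalso
        have hhalf : (1 / 2 : ℝ) ∈ Ioo (0 : ℝ) 1 := ⟨by norm_num, by norm_num⟩
        have hq₀J : p (1 / 2) ∈ J := ⟨1 / 2, ⟨by norm_num, by norm_num⟩, rfl⟩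
        have hq₀B : p (1 / 2) ∈ closure B := by
          rw [← hfrB] at hq₀J; exact frontier_subset_closure hq₀J
        obtain ⟨q, hqG, hqB⟩ := mem_closure_iff_nhds.1 hq₀B G (hGo.mem_nhds (hpG _ hhalf))
        obtain ⟨w, hw, rfl⟩ := hFsurj q hqG
        have hqA : F w ∉ A := fun h' ↦ Set.disjoint_left.1 hAB h' hqB
        rcases hcover w hw with hw' | hw' | ⟨s, hs, rfl⟩
        · exact hqA (h₁ ⟨w, hw', rfl⟩)
        · exact hqA (h ⟨w, hw', rfl⟩)
        · have : p s ∈ Jᶜ := hABJ ▸ (Or.inr hqB : p s ∈ A ∪ B)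
          exact this ⟨s, ⟨hs.1.le, hs.2.le⟩, rfl⟩
      · exact h
    -- boundary values off `z`: on `(a, b)` in `A`, beyond `b` in `B`
    have hclA : closure A ⊆ A ∪ J := by rw [closure_eq_self_union_frontier, hfrA]
    have hclB : closure B ⊆ B ∪ J := by rw [closure_eq_self_union_frontier, hfrB]
    have hoffJ : ∀ x : ℝ, F x ≠ z → F x ∉ J := fun x hxz hxJ ↦
      (hJsub _ hxJ).elim (hfrG' _ (hFfr x)) hxz
    have hA : ∀ x ∈ Ioo a b, F x ≠ z → F x ∈ A := fun x hx hxz ↦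
      (hclA (closure_mono h₁ (hbv₁ x hx))).resolve_right (hoffJ x hxz)
    have hB : ∀ x : ℝ, b < x → F x ≠ z → F x ∈ B := fun x hx hxz ↦
      (hclB (closure_mono h₂ (hbv₂ x hx))).resolve_right (hoffJ x hxz)
    -- non-constancy of the boundary values
    obtain ⟨x₁, hx₁, hx₁z⟩ := hγ.exists_bdryInv_ne hW t hab z hzG
    obtain ⟨x₂, hx₂, hx₂z⟩ := hγ.exists_bdryInv_ne hW t (lt_add_one b) z hzG
    -- both boundary points lie in the connected set `M` off `J`: contradiction
    have hx₁M : F x₁ ∈ M := hfrM _ (hFfr x₁) hx₁z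
    have hx₂M : F x₂ ∈ M := hfrM _ (hFfr x₂) hx₂z
    rcases hMc.subset_or_subset hAo hBo hAB (hAB' ▸ hMJ) with h | h
    · exact Set.disjoint_left.1 hAB (h hx₂M) (hB x₂ hx₂.1 hx₂z)
    · exact Set.disjoint_left.1 hAB (hA x₁ hx₁ hx₁z) (h hx₁M)
  rcases hS₁c.subset_or_subset hUo hVo hUV hS₁J with h | h
  · exact key U V hUo hVo hUV hUVJ hfU hfV h
  · exact key V U hVo hUo hUV.symm (union_comm U V ▸ hUVJ) hfV hfU h

/-- **The tip at a first-visit time has a unique real preimage under `f̄ₜ`.** If the chain of the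
continuous driving function `W` is generated by `γ` and `γ t ∉ γ [0, t)`, then the only real
`x` with `f̄ₜ x = γ t` is `x = W t` (i.e. `γ t` is the principal point of exactly one prime end
of `Hₜ`, the one at `W t`). Lawler (2005), §4.1 and Prop. 4.31 (`f̄ₜ (W t) = γ t`); the
uniqueness is the Jordan-curve argument above. [cite: Lawler2005, §4.1 and Prop. 4.31] -/
theorem IsGeneratedByCurve.eq_driving_of_bdryInv_eq_of_notMem (hγ : IsGeneratedByCurve W γ)
    (hW : Continuous W) {t : ℝ≥0} (ht : γ t ∉ γ '' Iio t) {x : ℝ} (hx : bdryInv W t x = γ t) :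
    x = W t := by
  rcases eq_or_ne t 0 with rfl | ht0
  · rw [hγ.bdryInv_zero_ofReal hW x, hγ.apply_zero] at hx
    exact_mod_cast hx
  · have ht0' : 0 < t := pos_iff_ne_zero.2 ht0
    have hWt : bdryInv W t (W t) = γ t := hγ.bdryInv_driving hW t
    by_contra hne
    rcases lt_or_gt_of_ne hne with h | h
    · exact hγ.false_of_bdryInv_eq_of_lt hW ht0' ht h hx hWt
    · exact hγ.false_of_bdryInv_eq_of_lt hW ht0' ht h hWt hx

/-- **The tip at a first-visit time has a unique real preimage under the extended inverse
Loewner map** (`extendFrom ℍₒ fₜ = Loewner.bdryInv W t`): brick B1 of the domain Markov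
property of the SLE trace. [cite: Lawler2005, §4.1 and Prop. 4.31] -/
theorem IsGeneratedByCurve.eq_driving_of_extendFrom_loewnerInv_eq {W : ℝ≥0 → ℝ} {γ : ℝ≥0 → ℂ}
    (hW : Continuous W) (hγ : IsGeneratedByCurve W γ) {t : ℝ≥0} (ht : γ t ∉ γ '' Set.Iio t)
    {x : ℝ} (hx : extendFrom upperHalfPlaneSet (loewnerInv W t) x = γ t) : x = W t :=
  hγ.eq_driving_of_bdryInv_eq_of_notMem hW ht hx

end Tip

end Loewner

/-- Registered one-line form of `Loewner.IsGeneratedByCurve.eq_driving_of_extendFrom_loewnerInv_eq`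
(stub `stub_tipUniquePreimage` of the domain Markov property of chordal SLE).
[cite: Lawler2005, §4.1 and Prop. 4.31] -/
theorem stub_tipUniquePreimage : ∀ (W : NNReal → ℝ) (γ : NNReal → ℂ), Continuous W →
    Loewner.IsGeneratedByCurve W γ → ∀ (t : NNReal), γ t ∉ γ '' Set.Iio t → ∀ (x : ℝ),
    extendFrom UpperHalfPlane.upperHalfPlaneSet (Loewner.loewnerInv W t) x = γ t → x = W t :=
  fun _ _ hW hγ _ ht _ hx ↦ hγ.eq_driving_of_extendFrom_loewnerInv_eq hW ht hx

end Literature.Probability.RandomPlanarGeometry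

end
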